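import Summits.QuantumFields.YangMills.Theorems.BalabanUVNodesK0PrintCubeOfStepTokensGridGuardedB
import Summits.QuantumFields.YangMills.Theorems.BalabanUVNodesN07Thm1Top7FromProp8GuardedB
import Literature.MathematicalPhysics.QuantumFieldTheory.Balaban1983to89.Node00.Record12BgRowCoClassGaugeRGuardedBRowLam
import Literature.MathematicalPhysics.QuantumFieldTheory.Balaban1983to89.Node00.Record13LettersOfThm1CCMWZB
import Literature.MathematicalPhysics.QuantumFieldTheory.Balaban1983to89.Node00.Record13SepCoPLiveSelectorZ
import Literature.MathematicalPhysics.QuantumFieldTheory.Balaban1983to89.Node00.Record13SepCoPRInhabitedOfSepCoP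
import Literature.MathematicalPhysics.QuantumFieldTheory.Balaban1983to89.Node00.Record13SepCoPInhabitedOfThm1CCMGaugeR

/-!
# K0⁷ AT THE LETTER-FREE Z3 FAMILY OVER PRINT'S [II] (2.3) DATUM — the `(lamDatum F, Dat, UbgMSCoPOfRecordB)` twin of L3 §5 `…K0AllTorusOfStepTokensGuardedZB`: row P11 at the Co carrier of
# `θ₁₅ᶜᶜᴹᵂᶻᴮ(j; γ; εbg)` under the grid guard `A‴(c, c₀, c₁)` from the ᴮ (8)∕(9) sentences, the Z-socket closers ⁵→⁶→⁷, PART 1 at the Z3 member, and the three-stub composition over the ᴮ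
# tokens — with the Stage-2 SEAM displayed as ONE hypothesis `hseam` and the (7) data transfer as ONE hypothesis `hDat`

Cell `pub-ymgap`, seat `pub-ymgap-k0-s1-w1` g9 (K0⁷ **stmt-QuantumFields-20541**; (E1)∕(iii-b) WORKPLAN-IIIB 27c850bec22d4efe Stage 3 «L3 §5′»; director-ym №338 ∕ №339 (α) ∕ №343 (D1)
«`UbgOfRecord₁₃CoP (n+1) := UbgMSCoPOfRecordB …`» ∕ №346 (T2: `…GuardedZB` re-key + `K0V23Defs`); FLAG №16 ∕ LOCATE-HSEAM 5d3298b8d191f169; kernel road-scan ROADSCAN-IIIB-g9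
53ea8804079dcb1a).  `--kind proof --supports stmt-QuantumFields-20541 --as helper` (count-neutral).  THEOREMS ONLY (0 `def`, 0 `sorry`).  NEW additive leaf; the (b)-instance
`…K0AllTorusOfStepTokensGuardedZB` stays landed and true on its own text (honesty guard №338 (5)); nothing in the tree is edited.

WHY THIS FILE EXISTS NOW (before the seam edit).  L3 §5 reads the Stage-2 seam at exactly ONE place — `rw [UbgOfRecord₁₃CoP_succ]` in §1, turning the `bg` row of `Provisos₁₃SepCoP` (stated over
`UbgOfRecord₁₃CoP` BY NAME, Z socket `provisos₁₃SepCoP_theta13LiveOfNumericsZ_of_bgSepCoP`) into a row about the CoP background; everything else is θ-family bookkeeping over §1.  Over print's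
datum the row needs the background to BE a `Λ`-minimiser — node00-def-R's S2b `UbgMSCoPOfRecordB` (✓, additive) — and the seam edit makes `UbgOfRecord₁₃CoP (n+1)` unfold to it.  This file
therefore DISPLAYS the seam as the hypothesis `hseam : ∀ θ p n s W, UbgOfRecord₁₃CoP F N θ p (n+1) s W = UbgMSCoPOfRecordB F N θ.ν θ.τ9.M (gOfRecord₁₃ F N θ p) p.K (n+1) s W` (after the seam
edit: `fun _ _ _ _ _ => UbgOfRecord₁₃CoP_succ …`, one line; before it: NOT provable — the (b) background is not the `Λ`-minimiser — and NOT claimed), and the (7) data clause of the ᴮ sentences as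
a PARAMETER `Dat : TopData F N` with the pointwise transfer `hDat` from the support's `Sect2.DataSmall7PTop` at torus-compatible prefixes (at `Dat := dataSmall7PTopOf F N` it is `id`; at
print's `dataSmall7LamTopOf F N` it is P0's `dataSmall7LamTopOf_of_seq` with `blockSat_seqOfRecord` from `PartCompat₁₃`).  So the whole composition is KERNEL-CHECKED TODAY, and after the
campaign the V23 closing file is «discharge `hseam` by `UbgOfRecord₁₃CoP_succ`, `hDat` by the transfer, cite ★★★ below» — with NO dependency on the coherence train beyond the modules this
file imports (import-closure census k0-s1-w1 g9 2026-08-30: after (D4)∕(D4′) its closure meets the train only in `Record13SepCoPRInhabitedOfSepCoP` ∕ `Record13SepCoPInhabitedOfThm1CCMGaugeR`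
(the datum-free lifts ⁵→⁶→⁷) and `…K0PrintCubeOfStepTokensRFloor` (one arithmetic letter behind `…GridGuardedB`)).  The non-wrapping binder `hsN` and the level letter are RE-DERIVED
inline from `PartCompat₁₃` ∧ (C1) (the (b) road's `Stage13Params.hsN_of_partCompat₁₃` ∕ `succ_add_le_of_partCompat₁₃` live in train modules and are not imported).

WHAT IS PROVED (proofs = L3 §5's terms with the ᴮ names; every [15]∕[6] sentence is a HYPOTHESIS, never asserted).
* §1 ★★ `bgSepCoPAt_theta13OfThm1CCMWZB_gridGuard_of_thm1RegSepCoP7MGB_of_thm1GaugeGB_lam` — the `Provisos₁₃SepCoP`-shaped `bg` row at the Z3 member from `VariationalThm1RegSepCoP7MGB … A‴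
  (lamDatum F) Dat …` (S1a-C) and `VariationalThm1GaugeRegSepCoP7MGB … (L^j) A‴ (lamDatum F) Dat …` (S1b-2) + `hDat` + `hseam` (k0-s1-w1's `bgRowAtDatumCoPB_…` ∘ def-R's
  `ubgMSCoPOfRecordB_dichotomy`).
* §2 the closers `provisos₁₃SepCoP_… ∕ exists_k0SepCoP_… ∕ exists_k0SepCoPH_…_lam`, the (9)-step form (S1b-2 `variationalThm1GaugeRegSepCoP7MGB_of_gauge9TopStepGB`) and the (8)-step form (53′
  `variationalThm1RegSepCoP7MGB_of_prop8TopStepGB_lamDatum`).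
* §4 ★ `exists_k0H_of_thm1CoP7MGB_of_gauge9GB_of_absBoxZB_lam` (one abs β-box of the half-window member ⟹ the body; the (b) file's `clausesH_of_absBoxZB` inlined), ★★
  `record13SepCoPHBody_of_stub1GB_of_gauge9SupplierGB_of_absBetaBoxAtGBZB_lam` (generic (9)-supplier over the ᴮ tokens) (NODE O's θ-generic socket `absBetaBoxAtG3ZB_of_jetsFreePairAtG3ZB` re-keys the same way; not repeated here).
* §5 ★★★ `record13SepCoPHBody_of_stubs1GB_2P_3A'GBZB_lam (hDat) (hseam) (h1GB) (h2P) (h3A'GB) : ∀ F, ∃ θ : Stage13HParams F 2, θ.Provisos₁₃SepCoPH F 2 ∧ …` — the V23-shaped composition: stub 1ᴮ =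
  `∃ c c₀ c₁ B₃ a₀ a₁, 2L² ≤ B₃ ∧ 0 < a₀ ∧ 0 < a₁ ∧ Prop8RegSepTopStepGB F 2 suppDom A‴ (lamDatum F) (DatF F) B₃ a₀ a₁`, stub 2′ VERBATIM (landed p595104), stub 3ᴬ′ᴮ = the Z3 β-box text with both
  antecedents over `(lamDatum F, DatF F)`; the (9)-supplier is dag-n07-w2's `gauge9SupplierG3B_of_prop6MemberP`.
HONEST SCOPE.  Count-neutral kernel bookkeeping; CONDITIONAL on `hseam` (the Stage-2 seam — NOT in the tree at filing time), `hDat`, the two ᴮ [15] sentences and the stub texts (CANDIDATES —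
V23 is NOT registered; a re-text is not progress); nothing of Bałaban asserted; `stub_prop8StepCoPGridG13` ∕ K0⁷ NOT closed; N07 NOT discharged; counts unmoved (typed 28∕28 · discharged 8∕28);
R4 = the conditional finite-𝕋⁴ rung `BalabanLadder.UV` only — NOT continuum ∕ ℝ⁴ ∕ OS; the Yang–Mills mass gap (Clay) is NOT proved by any of this.  No `def`, `instance`, `notation`, `sorry`.

References: [15] = [Balaban1985Variational] (6)–(7) p.278, Thm 1 (8)–(9) p.279, (144)–(152) pp.300–301, Prop. 8 p.304; [6] = [Balaban1985RegularSpaces] (1.3)–(1.9) p.77, Prop. 6 p.99;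
[II] = [Balaban1984PropagatorsII] (2.3) p.224; [III] = [Balaban1988Convergent] Thm 1 p.262, (2.1) p.254, (2.12)–(2.13) p.256, (2.18) p.257, (2.27)–(2.28) p.259; [I] = [Balaban1987RG1]
Thm 1 p.259, (0.1) p.251, (1.12) p.262, (1.20)–(1.22) p.264; [IV] = [Balaban1989LargeFieldI] (0.2)–(0.4) p.176.
-/

noncomputable section

open MeasureTheory
open scoped Matrix.Norms.L2Operator

namespace Summit.QuantumFields.YangMills.Theorems.K0AllTorusOfStepTokensGuardedZBLam

open Literature.MathematicalPhysics.QuantumFieldTheory.Balaban1983to89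
open Literature.MathematicalPhysics.QuantumFieldTheory.Balaban1983to89.Node00
open Literature.MathematicalPhysics.QuantumFieldTheory.Balaban1983to89.T4Continuum
open Literature.MathematicalPhysics.QuantumFieldTheory.Balaban1983to89.FlowStep
open Literature.MathematicalPhysics.QuantumFieldTheory.Balaban1983to89.FlowStepRuns
open Literature.MathematicalPhysics.QuantumFieldTheory.Balaban1983to89.B14.Eq218Concrete
open Literature.MathematicalPhysics.QuantumFieldTheory.Balaban1983to89.B15DeterminingSets
open Literature.MathematicalPhysics.QuantumFieldTheory.Balaban1983to89.B12RegularSpaces111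
open Literature.MathematicalPhysics.QuantumFieldTheory.Balaban1983to89.B14RegularSpaces234
open Literature.MathematicalPhysics.QuantumFieldTheory.Balaban1983to89.B8LeafModelZd (ZdIdx)
open Summit.QuantumFields.YangMills.BalabanUVNodes.N07Thm1Top7FromProp8GuardedB (variationalThm1RegSepCoP7MGB_of_prop8TopStepGB_lamDatum)
open Summit.QuantumFields.YangMills.Theorems.K0PrintCubeOfStepTokensGridGuardedB (gauge9SupplierG3B_of_prop6MemberP)

/-! ## §1  ★★ Row P11 at the Co carrier AT THE Z3 MEMBER under the four-conjunct grid guard (`c ≤ L^j`, `c₀ ≤ j + 1`, `c₁ ≤ j`) — k0-s1-w3 §2 at Z3 -/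

section AtWitnessGridGuardZB

variable {F : T4Family} {N : ℕ} [NeZero N] {Dat : TopData F N} {j c c₀ c₁ : ℕ} {γ εbg ε₀ ε₂₉ B₃ B₃' a₀ a₁ : ℝ} {Efl logz : B12.RunParams → ℕ → ℝ}

/-- **★★ THE (7)-GUARDED SEPARATED ROW P11 AT THE Co CARRIER AT `θ₁₅ᶜᶜᴹᵂᶻᴮ(j; γ; εbg)` UNDER THE FOUR-CONJUNCT CANDIDATE GUARD**
`Adm := fun ν M g K k _ => c ≤ ν.M₁ ∧ k + c₀ ≤ F.m + K ∧ F.L ^ c₁ ∣ M ∧ ∀ i, 1 ≤ i → i ≤ k → dCubeSide (F.P K).L M (RkOfRecord (F.P K).L ν.r (g i)) i ∣ (F.P K).sitesPerDir 0`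
with `c ≤ L^j`, `c₀ ≤ j + 1`, `c₁ ≤ j` — k0-s1-w3's `…K0Stub1GridNumericsGuardWitness` §2 VERBATIM but for the witness (Z3 member, A2ʷ-ZB letters, one new sign `0 < εbg`): p635083 §1's all-torus lift (guard-generic, outer `hAdm`) with `hAdm` DISCHARGED at every
torus-compatible run of the window by: the floor (`ν.M₁ = L^j ≥ c`), the level letter (p635083 §0: `n + j + 1 ≤ F.m + p.K`), the cube letter `τ9.M = L^j` (`L^{c₁} ∣ L^j`),
and `PartCompat₁₃ F N θ p n` ITSELF (the fourth conjunct at `(θ.ν, θ.τ9.M, gOfRecord₁₃ θ p, p.K, n)`, by `rfl`).  CONDITIONAL on the two [15] sentences; nothing asserted.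
[cite: Balaban1985Variational, (6)–(7) p.278, Thm 1 (8)–(9) p.279, (144)–(152) pp.300–301, Prop. 8 p.304, p.304 lines 1–2; Balaban1985RegularSpaces, (1.3)–(1.9) p.77; Balaban1988Convergent, Thm 1 p.262, (2.1) p.254, (2.4)–(2.8) pp.255–256, (2.12)–(2.13) pp.256–257, (2.17)–(2.18) p.257, (2.25)–(2.28) pp.258–259; Balaban1987RG1, Thm 1 p.259, (0.1) p.251, (1.12) p.262] -/
theorem bgSepCoPAt_theta13OfThm1CCMWZB_gridGuard_of_thm1RegSepCoP7MGB_of_thm1GaugeGB_lam (hγ0 : 0 < γ) (hγ : γ ≤ 1 / 2) (hbg : 0 < εbg) (hε : 0 < ε₀) (hε' : 0 < ε₂₉) (hB : 0 ≤ B₃) (hB' : 0 ≤ B₃')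
    (ha₀ : 0 < a₀) (ha₁ : 0 < a₁) (hc : c ≤ F.L ^ j) (hc₀ : c₀ ≤ j + 1) (hc₁ : c₁ ≤ j)
    (h15 : VariationalThm1RegSepCoP7MGB F N (fun ν M g K k _s => c ≤ ν.M₁ ∧ k + c₀ ≤ F.m + K ∧ F.L ^ c₁ ∣ M ∧
      ∀ i, 1 ≤ i → i ≤ k → dCubeSide (F.P K).L M (RkOfRecord (F.P K).L ν.r (g i)) i ∣ (F.P K).sitesPerDir 0) (lamDatum F) Dat B₃ a₀ a₁)
    (h15G : VariationalThm1GaugeRegSepCoP7MGB F N (F.L ^ j) (fun ν M g K k _s => c ≤ ν.M₁ ∧ k + c₀ ≤ F.m + K ∧ F.L ^ c₁ ∣ M ∧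
      ∀ i, 1 ≤ i → i ≤ k → dCubeSide (F.P K).L M (RkOfRecord (F.P K).L ν.r (g i)) i ∣ (F.P K).sitesPerDir 0) (lamDatum F) Dat B₃ B₃' a₀ a₁)
    (hDat : ∀ (θ : Stage13Params F N) (p : B12.RunParams) (n : ℕ) (s : SeqOfRecord F θ.ν θ.τ9.M (gOfRecord₁₃ F N θ p) p.K n) (δ : ℕ → ℝ) (W : MSField (F.P p.K) (SU N)),
      n ≤ p.K → PartCompat₁₃ F N θ p n →
      Sect2.DataSmall7PTop (avOfRecord F N p.K) s.Ω (suppDomOfRecord F θ.ν p.K s.Ω) n δ W → Dat p.K s.Ω (suppDomOfRecord F θ.ν p.K s.Ω) n δ W)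
    (hseam : ∀ (θ : Stage13Params F N) (p : B12.RunParams) (n : ℕ) (s : SeqOfRecord F θ.ν θ.τ9.M (gOfRecord₁₃ F N θ p) p.K (n + 1)) (W : MSField (F.P p.K) (SU N)),
      UbgOfRecord₁₃CoP F N θ p (n + 1) s W = UbgMSCoPOfRecordB F N θ.ν θ.τ9.M (gOfRecord₁₃ F N θ p) p.K (n + 1) s W)
    (hcomp : ∀ (p : B12.RunParams) (n : ℕ), n ≤ p.K → Step.InInterval (theta13OfThm1CCMWZB F N j γ εbg ε₀ ε₂₉ B₃ B₃' a₀ a₁ Efl logz).γ n (gOfRecord₁₃ F N (theta13OfThm1CCMWZB F N j γ εbg ε₀ ε₂₉ B₃ B₃' a₀ a₁ Efl logz) p) → ∀ m, m < n →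
      (theta13OfThm1CCMWZB F N j γ εbg ε₀ ε₂₉ B₃ B₃' a₀ a₁ Efl logz).s2.cR * epsOfRecord (theta13OfThm1CCMWZB F N j γ εbg ε₀ ε₂₉ B₃ B₃' a₀ a₁ Efl logz).ν (gOfRecord₁₃ F N (theta13OfThm1CCMWZB F N j γ εbg ε₀ ε₂₉ B₃ B₃' a₀ a₁ Efl logz) p) m ≤ 2 * ((theta13OfThm1CCMWZB F N j γ εbg ε₀ ε₂₉ B₃ B₃' a₀ a₁ Efl logz).s2.cR * epsOfRecord (theta13OfThm1CCMWZB F N j γ εbg ε₀ ε₂₉ B₃ B₃' a₀ a₁ Efl logz).ν (gOfRecord₁₃ F N (theta13OfThm1CCMWZB F N j γ εbg ε₀ ε₂₉ B₃ B₃' a₀ a₁ Efl logz) p) (m + 1)))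
    (hcompRev : ∀ (p : B12.RunParams) (n : ℕ), n ≤ p.K → Step.InInterval (theta13OfThm1CCMWZB F N j γ εbg ε₀ ε₂₉ B₃ B₃' a₀ a₁ Efl logz).γ n (gOfRecord₁₃ F N (theta13OfThm1CCMWZB F N j γ εbg ε₀ ε₂₉ B₃ B₃' a₀ a₁ Efl logz) p) → ∀ m, m < n →
      (theta13OfThm1CCMWZB F N j γ εbg ε₀ ε₂₉ B₃ B₃' a₀ a₁ Efl logz).s2.cR * epsOfRecord (theta13OfThm1CCMWZB F N j γ εbg ε₀ ε₂₉ B₃ B₃' a₀ a₁ Efl logz).ν (gOfRecord₁₃ F N (theta13OfThm1CCMWZB F N j γ εbg ε₀ ε₂₉ B₃ B₃' a₀ a₁ Efl logz) p) (m + 1) ≤ 2 * ((theta13OfThm1CCMWZB F N j γ εbg ε₀ ε₂₉ B₃ B₃' a₀ a₁ Efl logz).s2.cR * epsOfRecord (theta13OfThm1CCMWZB F N j γ εbg ε₀ ε₂₉ B₃ B₃' a₀ a₁ Efl logz).ν (gOfRecord₁₃ F N (theta13OfThm1CCMWZB F N j γ εbg ε₀ ε₂₉ B₃ B₃' a₀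 a₁ Efl logz) p) m)) :
    ∀ (p : B12.RunParams) (n : ℕ), n ≤ p.K → Step.InInterval (theta13OfThm1CCMWZB F N j γ εbg ε₀ ε₂₉ B₃ B₃' a₀ a₁ Efl logz).γ n (gOfRecord₁₃ F N (theta13OfThm1CCMWZB F N j γ εbg ε₀ ε₂₉ B₃ B₃' a₀ a₁ Efl logz) p) → PartCompat₁₃ F N (theta13OfThm1CCMWZB F N j γ εbg ε₀ ε₂₉ B₃ B₃' a₀ a₁ Efl logz) p n →
      ∀ s : SeqOfRecord F (theta13OfThm1CCMWZB F N j γ εbg ε₀ ε₂₉ B₃ B₃' a₀ a₁ Efl logz).ν (theta13OfThm1CCMWZB F N j γ εbg ε₀ ε₂₉ B₃ B₃' a₀ a₁ Efl logz).τ9.M (gOfRecord₁₃ F N (theta13OfThm1CCMWZB F N j γ εbg ε₀ ε₂₉ B₃ B₃' a₀ a₁ Efl logz) p) p.K n, Sect2.SeqSeparated (theta13OfThm1CCMWZB F N j γ εbg ε₀ ε₂₉ B₃ B₃' a₀ a₁ Efl logz).ν.M₁ s →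
      ∀ W : MSField (F.P p.K) (SU N), W ∈ suppOfRecord₁₃P F N (theta13OfThm1CCMWZB F N j γ εbg ε₀ ε₂₉ B₃ B₃' a₀ a₁ Efl logz) p n s →
      Sect2.DataSmall7PTop (avOfRecord F N p.K) s.Ω (suppDomOfRecord F (theta13OfThm1CCMWZB F N j γ εbg ε₀ ε₂₉ B₃ B₃' a₀ a₁ Efl logz).ν p.K s.Ω) n (fun j' => (theta13OfThm1CCMWZB F N j γ εbg ε₀ ε₂₉ B₃ B₃' a₀ a₁ Efl logz).s2.cR * epsOfRecord (theta13OfThm1CCMWZB F N j γ εbg ε₀ ε₂₉ B₃ B₃' a₀ a₁ Efl logz).ν (gOfRecord₁₃ F N (theta13OfThm1CCMWZB F N j γ εbg ε₀ ε₂₉ B₃ B₃' a₀ a₁ Efl logz) p) j') W →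
      ∀ j', 1 ≤ j' → j' ≤ n → ∀ X : (Sect2.domSys (F.P p.K) (theta13OfThm1CCMWZB F N j γ εbg ε₀ ε₂₉ B₃ B₃' a₀ a₁ Efl logz).τ9.M j').Dom,
      (Sect2.domSites (F.P p.K) (theta13OfThm1CCMWZB F N j γ εbg ε₀ ε₂₉ B₃ B₃' a₀ a₁ Efl logz).τ9.M j' X ⊆ s.Λ j' →
        Sect2.ofBackgroundC (settingOfRecord₁₃ F N (theta13OfThm1CCMWZB F N j γ εbg ε₀ ε₂₉ B₃ B₃' a₀ a₁ Efl logz) p).ι (UbgOfRecord₁₃CoP F N (theta13OfThm1CCMWZB F N j γ εbg ε₀ ε₂₉ B₃ B₃' a₀ a₁ Efl logz) p n s W) ∈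
          Sect2.spaceI (settingOfRecord₁₃ F N (theta13OfThm1CCMWZB F N j γ εbg ε₀ ε₂₉ B₃ B₃' a₀ a₁ Efl logz) p) ((theta13OfThm1CCMWZB F N j γ εbg ε₀ ε₂₉ B₃ B₃' a₀ a₁ Efl logz).Rz p.K) (theta13OfThm1CCMWZB F N j γ εbg ε₀ ε₂₉ B₃ B₃' a₀ a₁ Efl logz).τ9.M j' (Sect2.domSites (F.P p.K) (theta13OfThm1CCMWZB F N j γ εbg ε₀ ε₂₉ B₃ B₃' a₀ a₁ Efl logz).τ9.M j' X)
            ((settingOfRecord₁₃ F N (theta13OfThm1CCMWZB F N j γ εbg ε₀ ε₂₉ B₃ B₃' a₀ a₁ Efl logz) p).lf.alpha0 ((settingOfRecord₁₃ F N (theta13OfThm1CCMWZB F N j γ εbg ε₀ ε₂₉ B₃ B₃' a₀ a₁ Efl logz) p).flow.g j')) ((settingOfRecord₁₃ F N (theta13OfThm1CCMWZB F N j γ εbg ε₀ ε₂₉ B₃ B₃' a₀ a₁ Efl logz) p).lf.alpha1 ((settingOfRecord₁₃ F N (theta13OfThm1CCMWZB F N j γ εbg ε₀ ε₂₉ B₃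 B₃' a₀ a₁ Efl logz) p).flow.g j'))) ∧
      (Sect2.admB (F.P p.K) (theta13OfThm1CCMWZB F N j γ εbg ε₀ ε₂₉ B₃ B₃' a₀ a₁ Efl logz).ν (theta13OfThm1CCMWZB F N j γ εbg ε₀ ε₂₉ B₃ B₃' a₀ a₁ Efl logz).τ9.M (gOfRecord₁₃ F N (theta13OfThm1CCMWZB F N j γ εbg ε₀ ε₂₉ B₃ B₃' a₀ a₁ Efl logz) p) s.Ω s.Λ j' (Sect2.domSites (F.P p.K) (theta13OfThm1CCMWZB F N j γ εbg ε₀ ε₂₉ B₃ B₃' a₀ a₁ Efl logz).τ9.M j' X) = true →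
        Sect2.ofBackgroundC (settingOfRecord₁₃ F N (theta13OfThm1CCMWZB F N j γ εbg ε₀ ε₂₉ B₃ B₃' a₀ a₁ Efl logz) p).ι (UbgOfRecord₁₃CoP F N (theta13OfThm1CCMWZB F N j γ εbg ε₀ ε₂₉ B₃ B₃' a₀ a₁ Efl logz) p n s W) ∈
          Sect2.spaceMS (settingOfRecord₁₃ F N (theta13OfThm1CCMWZB F N j γ εbg ε₀ ε₂₉ B₃ B₃' a₀ a₁ Efl logz) p) ((theta13OfThm1CCMWZB F N j γ εbg ε₀ ε₂₉ B₃ B₃' a₀ a₁ Efl logz).Rz p.K) (theta13OfThm1CCMWZB F N j γ εbg ε₀ ε₂₉ B₃ B₃' a₀ a₁ Efl logz).τ9.M j' (Sect2.domSites (F.P p.K) (theta13OfThm1CCMWZB F N j γ εbg ε₀ ε₂₉ B₃ B₃' a₀ a₁ Efl logz).τ9.M j' X) s.Ω) := by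
  intro p n hn hw hpc s hsep W _ h7
  cases n with
  | zero => intro j' h1 hj'; exfalso; omega
  | succ n =>
    rw [hseam]
    have hθ : (theta13OfThm1CCMWZB F N j γ εbg ε₀ ε₂₉ B₃ B₃' a₀ a₁ Efl logz).Admissible F N :=
      admissible_theta13OfThm1CCMWZB_of_le_half F N Efl logz hγ0 hγ hbg hε hε' hB hB' ha₀ ha₁
    have hMa : (theta13OfThm1CCMWZB F N j γ εbg ε₀ ε₂₉ B₃ B₃' a₀ a₁ Efl logz).τ9.M = F.L ^ j := theta13OfThm1CCMWZB_τ9_M F N j γ εbg ε₀ ε₂₉ B₃ B₃' a₀ a₁ Efl logz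
    have hC1 : ∀ j', 1 ≤ j' → j' ≤ n + 1 → ∃ t : ℕ, 0 < t ∧
        RkOfRecord (F.P p.K).L (theta13OfThm1CCMWZB F N j γ εbg ε₀ ε₂₉ B₃ B₃' a₀ a₁ Efl logz).ν.r (gOfRecord₁₃ F N (theta13OfThm1CCMWZB F N j γ εbg ε₀ ε₂₉ B₃ B₃' a₀ a₁ Efl logz) p j') = (F.P p.K).L * t :=
      (hC1_theta13OfThm1CCMWZB hγ) p (n + 1) hn hw
    -- the level letter and the non-wrapping binder at this torus-compatible run (inlined: `L^e ∣ 2·L^f ⇒ e ≤ f` for `L` odd `> 1`, then `PartCompat₁₃` ∧ (C1))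
    have hcop : ∀ e f : ℕ, F.L ^ e ∣ 2 * F.L ^ f → e ≤ f := fun e f h =>
      (Nat.pow_dvd_pow_iff_le_right F.hL.2).mp ((Nat.Coprime.pow_left e (Odd.coprime_two_right F.hL.1)).dvd_of_dvd_mul_left h)
    have hlev : ∀ n', 1 ≤ n' → n' ≤ n + 1 → n' + j + 1 ≤ F.m + p.K := by
      intro n' h1 hn'
      obtain ⟨t, _, hR⟩ := hC1 n' h1 hn'
      have hdvd := hpc n' h1 hn'
      rw [hR, hMa] at hdvd
      have hd : F.L ^ n' * F.L ^ j * (F.L * t) ∣ 2 * F.L ^ (F.m + p.K - 0) := hdvd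
      rw [Nat.sub_zero] at hd
      exact hcop _ _ ((Dvd.intro t (by ring) : F.L ^ (n' + j + 1) ∣ F.L ^ n' * F.L ^ j * (F.L * t)).trans hd)
    have hsN : ∀ n', 1 ≤ n' → n' ≤ n + 1 + 1 → ((B14.Eq213MaximalDomains.side (F.P p.K).L (theta13OfThm1CCMWZB F N j γ εbg ε₀ ε₂₉ B₃ B₃' a₀ a₁ Efl logz).τ9.M n' : ℕ) : ℤ) < (F.P p.K).sitesPerDir 0 := by
      intro n' h1 hn'
      have hle : min n' (n + 1) + j + 1 ≤ F.m + p.K := hlev (min n' (n + 1)) (le_min h1 (by omega)) (min_le_right _ _)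
      have hn'j : n' ≤ min n' (n + 1) + 1 := by
        rcases Nat.le_or_le n' (n + 1) with h | h
        · rw [min_eq_left h]; omega
        · rw [min_eq_right h]; omega
      rw [hMa]
      have hLpos : 0 < F.L := by have := F.hL.2; omega
      have hnat : B14.Eq213MaximalDomains.side (F.P p.K).L (F.L ^ j) n' < (F.P p.K).sitesPerDir 0 := by
        show F.L ^ n' * F.L ^ j < 2 * F.L ^ (F.m + p.K - 0)
        rw [Nat.sub_zero, ← pow_add]
        have h1' : F.L ^ (n' + j) ≤ F.L ^ (F.m + p.K) := Nat.pow_le_pow_right hLpos (by omega)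
        have h0 : 0 < F.L ^ (F.m + p.K) := Nat.pow_pos hLpos
        omega
      exact_mod_cast hnat
    have hadm : c ≤ (theta13OfThm1CCMWZB F N j γ εbg ε₀ ε₂₉ B₃ B₃' a₀ a₁ Efl logz).ν.M₁ ∧ n + 1 + c₀ ≤ F.m + p.K ∧ F.L ^ c₁ ∣ (theta13OfThm1CCMWZB F N j γ εbg ε₀ ε₂₉ B₃ B₃' a₀ a₁ Efl logz).τ9.M ∧
        ∀ i, 1 ≤ i → i ≤ n + 1 → dCubeSide (F.P p.K).L (theta13OfThm1CCMWZB F N j γ εbg ε₀ ε₂₉ B₃ B₃' a₀ a₁ Efl logz).τ9.M (RkOfRecord (F.P p.K).L (theta13OfThm1CCMWZB F N j γ εbg ε₀ ε₂₉ B₃ B₃' a₀ a₁ Efl logz).ν.r (gOfRecord₁₃ F N (theta13OfThm1CCMWZB F N j γ εbg ε₀ ε₂₉ B₃ B₃' a₀ a₁ Efl logz) p i)) i ∣ (F.P p.K).sitesPerDir 0 := by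
      refine ⟨?_, ?_, ?_, hpc⟩
      · rw [theta13OfThm1CCMWZB_M₁]; exact hc
      · have h := hlev (n + 1) (by omega) le_rfl; omega
      · rw [hMa]; exact pow_dvd_pow F.L hc₁
    exact bgRowAtDatumCoPB_of_thm1RegSepCoP7MGB_of_thm1GaugeGB h15 h15G (settingOfRecord₁₃ F N (theta13OfThm1CCMWZB F N j γ εbg ε₀ ε₂₉ B₃ B₃' a₀ a₁ Efl logz) p) rfl rfl
      (settingOfRecord₁₃_laws F N (theta13OfThm1CCMWZB F N j γ εbg ε₀ ε₂₉ B₃ B₃' a₀ a₁ Efl logz) p) (settingOfRecord₁₃_pos F N (theta13OfThm1CCMWZB F N j γ εbg ε₀ ε₂₉ B₃ B₃' a₀ a₁ Efl logz) hθ.1.pos p) (theta13OfThm1CCMWZB F N j γ εbg ε₀ ε₂₉ B₃ B₃' a₀ a₁ Efl logz).ν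
      (τ9_M_pos_theta13OfThm1CCMWZB F N j γ εbg ε₀ ε₂₉ B₃ B₃' a₀ a₁ Efl logz) p.K (n + 1) (theta13OfThm1CCMWZB F N j γ εbg ε₀ ε₂₉ B₃ B₃' a₀ a₁ Efl logz).s2.cR
      ((hnum_theta13OfThm1CCMWZB hγ hB hB' ha₀ ha₁) p (n + 1) hn hw) εreg_le_theta13OfThm1CCMWZB (hcomp p (n + 1) hn hw) (hcompRev p (n + 1) hn hw)
      (fun m _ hm => alphaPos₁₃_of_inInterval hθ hw hm) ((hBα_theta13OfThm1CCMWZB hγ hB hB' ha₀.le ha₁.le) p (n + 1) hn hw)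
      ((htI_theta13OfThm1CCMWZB hγ hB hB' ha₀.le ha₁.le) p (n + 1) hn hw) ((htMS_theta13OfThm1CCMWZB hγ hB hB' ha₀.le ha₁.le) p (n + 1) hn hw) hC1 hpc hsN s hsep
      (M₁_pos_theta13OfThm1CCMWZB F N j γ εbg ε₀ ε₂₉ B₃ B₃' a₀ a₁ Efl logz) hadm W (hDat _ p (n + 1) s _ W hn hpc h7)

end AtWitnessGridGuardZB

/-! ## §3  Closers under the CANDIDATE guard, (hcomp) ∧ (hcompRev), on EVERY family — p635083 §3 with the guard replaced -/

section ClosersGridGuardZB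

variable {j c c₀ c₁ : ℕ} {γ εbg ε₀ ε₂₉ B₃ B₃' a₀ a₁ : ℝ} {Efl logz : B12.RunParams → ℕ → ℝ}

/-- **★ THE v1.5 PROVISOS `Provisos₁₃SepCoP` AT THE Z3 MEMBER, POINTED** (general `N`; the form a DOOR consumer reads — dag-n24-c's K1-face engine, dag-n11-w1's Gauss-pin rows):
the Z socket's constructor `provisos₁₃SepCoP_theta13LiveOfNumericsZ_of_bgSepCoP` (L2; `hM := ⟨j, rfl⟩`, `hM₁ := dvd_refl _`) fed by §1's row.  At the εbg = 1, `(Efl, logz) = (0, 0)` member this is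
NOT obtainable from the W row by `rfl` (β and the histories read `εbg` — DEF-1 g27), hence the genuine Z3 row of §1.  CONDITIONAL on the two [15] sentences and the clauses; nothing asserted.
[cite: Balaban1985Variational, (6)–(7) p.278, Thm 1 (8)–(9) p.279, (144)–(152) pp.300–301; Balaban1985RegularSpaces, (1.3)–(1.9) p.77; Balaban1988Convergent, Thm 1 p.262, (2.18) p.257, (2.28) p.259, (3.16) p.268, (3.22) p.269; Balaban1989LargeFieldI, (0.3)–(0.4) p.176] -/
theorem provisos₁₃SepCoP_theta13OfThm1CCMWZB_gridGuard_of_thm1RegSepCoP7MGB_of_thm1GaugeGB_lam (F : T4Family) (N : ℕ) [NeZero N] {Dat : TopData F N} (hγ0 : 0 < γ) (hγ : γ ≤ 1 / 2) (hbg : 0 < εbg) (hε : 0 < ε₀) (hε' : 0 < ε₂₉) (hB : 0 ≤ B₃)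
    (hB' : 0 ≤ B₃') (ha₀ : 0 < a₀) (ha₁ : 0 < a₁) (hc : c ≤ F.L ^ j) (hc₀ : c₀ ≤ j + 1) (hc₁ : c₁ ≤ j)
    (h15 : VariationalThm1RegSepCoP7MGB F N (fun ν M g K k _s => c ≤ ν.M₁ ∧ k + c₀ ≤ F.m + K ∧ F.L ^ c₁ ∣ M ∧
      ∀ i, 1 ≤ i → i ≤ k → dCubeSide (F.P K).L M (RkOfRecord (F.P K).L ν.r (g i)) i ∣ (F.P K).sitesPerDir 0) (lamDatum F) Dat B₃ a₀ a₁)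
    (h15G : VariationalThm1GaugeRegSepCoP7MGB F N (F.L ^ j) (fun ν M g K k _s => c ≤ ν.M₁ ∧ k + c₀ ≤ F.m + K ∧ F.L ^ c₁ ∣ M ∧
      ∀ i, 1 ≤ i → i ≤ k → dCubeSide (F.P K).L M (RkOfRecord (F.P K).L ν.r (g i)) i ∣ (F.P K).sitesPerDir 0) (lamDatum F) Dat B₃ B₃' a₀ a₁)
    (hDat : ∀ (θ : Stage13Params F N) (p : B12.RunParams) (n : ℕ) (s : SeqOfRecord F θ.ν θ.τ9.M (gOfRecord₁₃ F N θ p) p.K n) (δ : ℕ → ℝ) (W : MSField (F.P p.K) (SU N)),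
      n ≤ p.K → PartCompat₁₃ F N θ p n →
      Sect2.DataSmall7PTop (avOfRecord F N p.K) s.Ω (suppDomOfRecord F θ.ν p.K s.Ω) n δ W → Dat p.K s.Ω (suppDomOfRecord F θ.ν p.K s.Ω) n δ W)
    (hseam : ∀ (θ : Stage13Params F N) (p : B12.RunParams) (n : ℕ) (s : SeqOfRecord F θ.ν θ.τ9.M (gOfRecord₁₃ F N θ p) p.K (n + 1)) (W : MSField (F.P p.K) (SU N)),
      UbgOfRecord₁₃CoP F N θ p (n + 1) s W = UbgMSCoPOfRecordB F N θ.ν θ.τ9.M (gOfRecord₁₃ F N θ p) p.K (n + 1) s W)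
    (hcomp : ∀ (p : B12.RunParams) (n : ℕ), n ≤ p.K → Step.InInterval (theta13OfThm1CCMWZB F N j γ εbg ε₀ ε₂₉ B₃ B₃' a₀ a₁ Efl logz).γ n (gOfRecord₁₃ F N (theta13OfThm1CCMWZB F N j γ εbg ε₀ ε₂₉ B₃ B₃' a₀ a₁ Efl logz) p) → ∀ m, m < n →
      (theta13OfThm1CCMWZB F N j γ εbg ε₀ ε₂₉ B₃ B₃' a₀ a₁ Efl logz).s2.cR * epsOfRecord (theta13OfThm1CCMWZB F N j γ εbg ε₀ ε₂₉ B₃ B₃' a₀ a₁ Efl logz).ν (gOfRecord₁₃ F N (theta13OfThm1CCMWZB F N j γ εbg ε₀ ε₂₉ B₃ B₃' a₀ a₁ Efl logz) p) m ≤ 2 * ((theta13OfThm1CCMWZB F N j γ εbg ε₀ ε₂₉ B₃ B₃' a₀ a₁ Efl logz).s2.cR * epsOfRecord (theta13OfThm1CCMWZB F N j γ εbg ε₀ ε₂₉ B₃ B₃' a₀ a₁ Efl logz).ν (gOfRecord₁₃ F N (theta13OfThm1CCMWZB F N j γ εbg ε₀ ε₂₉ B₃ B₃' a₀ a₁ Efl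 logz) p) (m + 1)))
    (hcompRev : ∀ (p : B12.RunParams) (n : ℕ), n ≤ p.K → Step.InInterval (theta13OfThm1CCMWZB F N j γ εbg ε₀ ε₂₉ B₃ B₃' a₀ a₁ Efl logz).γ n (gOfRecord₁₃ F N (theta13OfThm1CCMWZB F N j γ εbg ε₀ ε₂₉ B₃ B₃' a₀ a₁ Efl logz) p) → ∀ m, m < n →
      (theta13OfThm1CCMWZB F N j γ εbg ε₀ ε₂₉ B₃ B₃' a₀ a₁ Efl logz).s2.cR * epsOfRecord (theta13OfThm1CCMWZB F N j γ εbg ε₀ ε₂₉ B₃ B₃' a₀ a₁ Efl logz).ν (gOfRecord₁₃ F N (theta13OfThm1CCMWZB F N j γ εbg ε₀ ε₂₉ B₃ B₃' a₀ a₁ Efl logz) p) (m + 1) ≤ 2 * ((theta13OfThm1CCMWZB F N j γ εbg ε₀ ε₂₉ B₃ B₃' a₀ a₁ Efl logz).s2.cR * epsOfRecord (theta13OfThm1CCMWZB F N j γ εbg ε₀ ε₂₉ B₃ B₃' a₀ a₁ Efl logz).ν (gOfRecord₁₃ F N (theta13OfThm1CCMWZB F N j γ εbg ε₀ ε₂₉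 B₃ B₃' a₀ a₁ Efl logz) p) m)) :
    (theta13OfThm1CCMWZB F N j γ εbg ε₀ ε₂₉ B₃ B₃' a₀ a₁ Efl logz).Provisos₁₃SepCoP F N :=
  provisos₁₃SepCoP_theta13LiveOfNumericsZ_of_bgSepCoP F N (stage12NumericsOfThm1CCMWB F.L j γ εbg ε₀ B₃ B₃' a₀ a₁) ε₂₉ Efl logz ⟨j, rfl⟩ (dvd_refl _)
    (bgSepCoPAt_theta13OfThm1CCMWZB_gridGuard_of_thm1RegSepCoP7MGB_of_thm1GaugeGB_lam hγ0 hγ hbg hε hε' hB hB' ha₀ ha₁ hc hc₀ hc₁ h15 h15G hDat hseam hcomp hcompRev)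

/-- **THE K0 BODY (⁵) FOR `F` AT `N = 2` AT `θ₁₅ᶜᶜᴹᵂᶻᴮ(j; γ; εbg)` UNDER THE CANDIDATE GUARD** (16a's socket ∘ the row above) — k0-s1-w3's first closer at the Z3 member, through the Z socket `exists_k0SepCoP_of_bgSepCoP_theta13LiveOfNumericsZ` (L2) and Z3's `stage12NumericsOfThm1CCMWB_pos_of_le_half`.
CONDITIONAL; K0 NOT closed here. [cite: Balaban1985Variational, Thm 1 (8)–(9) p.279, Prop. 8 p.304; Balaban1988Convergent, Thm 1 p.262, (2.1) p.254, (2.4)–(2.8) pp.255–256, p.257; Balaban1987RG1, Thm 1 p.259, (0.1) p.251] -/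
theorem exists_k0SepCoP_thm1CCMWZB_gridGuard_of_thm1RegSepCoP7MGB_of_thm1GaugeGB_lam (F : T4Family) {Dat : TopData F 2} (hγ0 : 0 < γ) (hγ : γ ≤ 1 / 2) (hbg : 0 < εbg) (hε : 0 < ε₀) (hε' : 0 < ε₂₉) (hB : 0 ≤ B₃)
    (hB' : 0 ≤ B₃') (ha₀ : 0 < a₀) (ha₁ : 0 < a₁) (hc : c ≤ F.L ^ j) (hc₀ : c₀ ≤ j + 1) (hc₁ : c₁ ≤ j)
    (h15 : VariationalThm1RegSepCoP7MGB F 2 (fun ν M g K k _s => c ≤ ν.M₁ ∧ k + c₀ ≤ F.m + K ∧ F.L ^ c₁ ∣ M ∧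
      ∀ i, 1 ≤ i → i ≤ k → dCubeSide (F.P K).L M (RkOfRecord (F.P K).L ν.r (g i)) i ∣ (F.P K).sitesPerDir 0) (lamDatum F) Dat B₃ a₀ a₁)
    (h15G : VariationalThm1GaugeRegSepCoP7MGB F 2 (F.L ^ j) (fun ν M g K k _s => c ≤ ν.M₁ ∧ k + c₀ ≤ F.m + K ∧ F.L ^ c₁ ∣ M ∧
      ∀ i, 1 ≤ i → i ≤ k → dCubeSide (F.P K).L M (RkOfRecord (F.P K).L ν.r (g i)) i ∣ (F.P K).sitesPerDir 0) (lamDatum F) Dat B₃ B₃' a₀ a₁)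
    (hDat : ∀ (θ : Stage13Params F 2) (p : B12.RunParams) (n : ℕ) (s : SeqOfRecord F θ.ν θ.τ9.M (gOfRecord₁₃ F 2 θ p) p.K n) (δ : ℕ → ℝ) (W : MSField (F.P p.K) (SU 2)),
      n ≤ p.K → PartCompat₁₃ F 2 θ p n →
      Sect2.DataSmall7PTop (avOfRecord F 2 p.K) s.Ω (suppDomOfRecord F θ.ν p.K s.Ω) n δ W → Dat p.K s.Ω (suppDomOfRecord F θ.ν p.K s.Ω) n δ W)
    (hseam : ∀ (θ : Stage13Params F 2) (p : B12.RunParams) (n : ℕ) (s : SeqOfRecord F θ.ν θ.τ9.M (gOfRecord₁₃ F 2 θ p) p.K (n + 1)) (W : MSField (F.P p.K) (SU 2)),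
      UbgOfRecord₁₃CoP F 2 θ p (n + 1) s W = UbgMSCoPOfRecordB F 2 θ.ν θ.τ9.M (gOfRecord₁₃ F 2 θ p) p.K (n + 1) s W)
    (hcomp : ∀ (p : B12.RunParams) (n : ℕ), n ≤ p.K → Step.InInterval (theta13OfThm1CCMWZB F 2 j γ εbg ε₀ ε₂₉ B₃ B₃' a₀ a₁ Efl logz).γ n (gOfRecord₁₃ F 2 (theta13OfThm1CCMWZB F 2 j γ εbg ε₀ ε₂₉ B₃ B₃' a₀ a₁ Efl logz) p) → ∀ m, m < n →
      (theta13OfThm1CCMWZB F 2 j γ εbg ε₀ ε₂₉ B₃ B₃' a₀ a₁ Efl logz).s2.cR * epsOfRecord (theta13OfThm1CCMWZB F 2 j γ εbg ε₀ ε₂₉ B₃ B₃' a₀ a₁ Efl logz).ν (gOfRecord₁₃ F 2 (theta13OfThm1CCMWZB F 2 j γ εbg ε₀ ε₂₉ B₃ B₃' a₀ a₁ Efl logz) p) m ≤ 2 * ((theta13OfThm1CCMWZB F 2 j γ εbg ε₀ ε₂₉ B₃ B₃' a₀ a₁ Efl logz).s2.cR * epsOfRecord (theta13OfThm1CCMWZB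 F 2 j γ εbg ε₀ ε₂₉ B₃ B₃' a₀ a₁ Efl logz).ν (gOfRecord₁₃ F 2 (theta13OfThm1CCMWZB F 2 j γ εbg ε₀ ε₂₉ B₃ B₃' a₀ a₁ Efl logz) p) (m + 1)))
    (hcompRev : ∀ (p : B12.RunParams) (n : ℕ), n ≤ p.K → Step.InInterval (theta13OfThm1CCMWZB F 2 j γ εbg ε₀ ε₂₉ B₃ B₃' a₀ a₁ Efl logz).γ n (gOfRecord₁₃ F 2 (theta13OfThm1CCMWZB F 2 j γ εbg ε₀ ε₂₉ B₃ B₃' a₀ a₁ Efl logz) p) → ∀ m, m < n →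
      (theta13OfThm1CCMWZB F 2 j γ εbg ε₀ ε₂₉ B₃ B₃' a₀ a₁ Efl logz).s2.cR * epsOfRecord (theta13OfThm1CCMWZB F 2 j γ εbg ε₀ ε₂₉ B₃ B₃' a₀ a₁ Efl logz).ν (gOfRecord₁₃ F 2 (theta13OfThm1CCMWZB F 2 j γ εbg ε₀ ε₂₉ B₃ B₃' a₀ a₁ Efl logz) p) (m + 1) ≤ 2 * ((theta13OfThm1CCMWZB F 2 j γ εbg ε₀ ε₂₉ B₃ B₃' a₀ a₁ Efl logz).s2.cR * epsOfRecord (theta13OfThm1CCMWZB F 2 j γ εbg ε₀ ε₂₉ B₃ B₃' a₀ a₁ Efl logz).ν (gOfRecord₁₃ F 2 (theta13OfThm1CCMWZB F 2 j γ εbg ε₀ ε₂₉ B₃ B₃' a₀ a₁ Efl logz) p) m)) :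
    ∃ θ : Stage13Params F 2, θ.Provisos₁₃SepCoP F 2 ∧ (θ.ZtUnity F 2 ∧ θ.SlotsNondegenerate₁₃ F 2) ∧ θ.Admissible F 2 :=
  exists_k0SepCoP_of_bgSepCoP_theta13LiveOfNumericsZ F (stage12NumericsOfThm1CCMWB_pos_of_le_half (L := F.L) (j := j) F.hL.2.le hγ0 hγ hbg hε hB hB' ha₀ ha₁) hε' ⟨j, rfl⟩ (dvd_refl _)
    (bgSepCoPAt_theta13OfThm1CCMWZB_gridGuard_of_thm1RegSepCoP7MGB_of_thm1GaugeGB_lam hγ0 hγ hbg hε hε' hB hB' ha₀ ha₁ hc hc₀ hc₁ h15 h15G hDat hseam hcomp hcompRev)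

/-- **THE ⁷ IMAGE, ON EVERY FAMILY, UNDER THE CANDIDATE GUARD** (FILE 18's cured lift, T's history-blind door) — k0-s1-w3's second closer at the Z3 member.  CONDITIONAL.
[cite: Balaban1985Variational, Thm 1 (8) p.279, Prop. 8 p.304; Balaban1988Convergent, Thm 1 p.262, (2.1) p.254, (2.21) p.258; Balaban1989LargeFieldI, (0.2)–(0.4) p.176] -/
theorem exists_k0SepCoPH_thm1CCMWZB_gridGuard_of_thm1RegSepCoP7MGB_of_thm1GaugeGB_lam (F : T4Family) {Dat : TopData F 2} (hγ0 : 0 < γ) (hγ : γ ≤ 1 / 2) (hbg : 0 < εbg) (hε : 0 < ε₀) (hε' : 0 < ε₂₉) (hB : 0 ≤ B₃)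
    (hB' : 0 ≤ B₃') (ha₀ : 0 < a₀) (ha₁ : 0 < a₁) (hc : c ≤ F.L ^ j) (hc₀ : c₀ ≤ j + 1) (hc₁ : c₁ ≤ j)
    (h15 : VariationalThm1RegSepCoP7MGB F 2 (fun ν M g K k _s => c ≤ ν.M₁ ∧ k + c₀ ≤ F.m + K ∧ F.L ^ c₁ ∣ M ∧
      ∀ i, 1 ≤ i → i ≤ k → dCubeSide (F.P K).L M (RkOfRecord (F.P K).L ν.r (g i)) i ∣ (F.P K).sitesPerDir 0) (lamDatum F) Dat B₃ a₀ a₁)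
    (h15G : VariationalThm1GaugeRegSepCoP7MGB F 2 (F.L ^ j) (fun ν M g K k _s => c ≤ ν.M₁ ∧ k + c₀ ≤ F.m + K ∧ F.L ^ c₁ ∣ M ∧
      ∀ i, 1 ≤ i → i ≤ k → dCubeSide (F.P K).L M (RkOfRecord (F.P K).L ν.r (g i)) i ∣ (F.P K).sitesPerDir 0) (lamDatum F) Dat B₃ B₃' a₀ a₁)
    (hDat : ∀ (θ : Stage13Params F 2) (p : B12.RunParams) (n : ℕ) (s : SeqOfRecord F θ.ν θ.τ9.M (gOfRecord₁₃ F 2 θ p) p.K n) (δ : ℕ → ℝ) (W : MSField (F.P p.K) (SU 2)),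
      n ≤ p.K → PartCompat₁₃ F 2 θ p n →
      Sect2.DataSmall7PTop (avOfRecord F 2 p.K) s.Ω (suppDomOfRecord F θ.ν p.K s.Ω) n δ W → Dat p.K s.Ω (suppDomOfRecord F θ.ν p.K s.Ω) n δ W)
    (hseam : ∀ (θ : Stage13Params F 2) (p : B12.RunParams) (n : ℕ) (s : SeqOfRecord F θ.ν θ.τ9.M (gOfRecord₁₃ F 2 θ p) p.K (n + 1)) (W : MSField (F.P p.K) (SU 2)),
      UbgOfRecord₁₃CoP F 2 θ p (n + 1) s W = UbgMSCoPOfRecordB F 2 θ.ν θ.τ9.M (gOfRecord₁₃ F 2 θ p) p.K (n + 1) s W)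
    (hcomp : ∀ (p : B12.RunParams) (n : ℕ), n ≤ p.K → Step.InInterval (theta13OfThm1CCMWZB F 2 j γ εbg ε₀ ε₂₉ B₃ B₃' a₀ a₁ Efl logz).γ n (gOfRecord₁₃ F 2 (theta13OfThm1CCMWZB F 2 j γ εbg ε₀ ε₂₉ B₃ B₃' a₀ a₁ Efl logz) p) → ∀ m, m < n →
      (theta13OfThm1CCMWZB F 2 j γ εbg ε₀ ε₂₉ B₃ B₃' a₀ a₁ Efl logz).s2.cR * epsOfRecord (theta13OfThm1CCMWZB F 2 j γ εbg ε₀ ε₂₉ B₃ B₃' a₀ a₁ Efl logz).ν (gOfRecord₁₃ F 2 (theta13OfThm1CCMWZB F 2 j γ εbg ε₀ ε₂₉ B₃ B₃' a₀ a₁ Efl logz) p) m ≤ 2 * ((theta13OfThm1CCMWZB F 2 j γ εbg ε₀ ε₂₉ B₃ B₃' a₀ a₁ Efl logz).s2.cR * epsOfRecord (theta13OfThm1CCMWZB F 2 j γ εbg ε₀ ε₂₉ B₃ B₃' a₀ a₁ Efl logz).ν (gOfRecord₁₃ F 2 (theta13OfThm1CCMWZB F 2 j γ εbg ε₀ ε₂₉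 B₃ B₃' a₀ a₁ Efl logz) p) (m + 1)))
    (hcompRev : ∀ (p : B12.RunParams) (n : ℕ), n ≤ p.K → Step.InInterval (theta13OfThm1CCMWZB F 2 j γ εbg ε₀ ε₂₉ B₃ B₃' a₀ a₁ Efl logz).γ n (gOfRecord₁₃ F 2 (theta13OfThm1CCMWZB F 2 j γ εbg ε₀ ε₂₉ B₃ B₃' a₀ a₁ Efl logz) p) → ∀ m, m < n →
      (theta13OfThm1CCMWZB F 2 j γ εbg ε₀ ε₂₉ B₃ B₃' a₀ a₁ Efl logz).s2.cR * epsOfRecord (theta13OfThm1CCMWZB F 2 j γ εbg ε₀ ε₂₉ B₃ B₃' a₀ a₁ Efl logz).ν (gOfRecord₁₃ F 2 (theta13OfThm1CCMWZB F 2 j γ εbg ε₀ ε₂₉ B₃ B₃' a₀ a₁ Efl logz) p) (m + 1) ≤ 2 * ((theta13OfThm1CCMWZB F 2 j γ εbg ε₀ ε₂₉ B₃ B₃' a₀ a₁ Efl logz).s2.cR * epsOfRecord (theta13OfThm1CCMWZB F 2 j γ εbg ε₀ ε₂₉ B₃ B₃' a₀ a₁ Efl logz).ν (gOfRecord₁₃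 F 2 (theta13OfThm1CCMWZB F 2 j γ εbg ε₀ ε₂₉ B₃ B₃' a₀ a₁ Efl logz) p) m)) :
    ∃ θ : Stage13HParams F 2, θ.Provisos₁₃SepCoPH F 2 ∧ (θ.ZhUnity F 2 ∧ θ.SlotsNondegenerate₁₃ F 2) ∧ θ.Admissible F 2 :=
  exists_k0SepCoPH_of_exists_k0SepCoPR (exists_k0SepCoPR_of_exists_k0SepCoP F
    (exists_k0SepCoP_thm1CCMWZB_gridGuard_of_thm1RegSepCoP7MGB_of_thm1GaugeGB_lam F hγ0 hγ hbg hε hε' hB hB' ha₀ ha₁ hc hc₀ hc₁ h15 h15G hDat hseam hcomp hcompRev))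

/-- **★★ THE ⁷ K0 BODY KEYED ON THE GUARDED (8) AND THE GUARDED (9)-STEP FACT AT `(L^j, Adm)` UNDER THE CANDIDATE GUARD, ON EVERY FAMILY** (dag-n07-e module 51's
`variationalThm1GaugeRegSepCoP7MG_of_gauge9TopStepG`, guard-generic) — k0-s1-w3's third closer at the Z3 member: the K0 body CLOSES at the print-regime-capable family exactly as at the
witness of record.  CONDITIONAL; nothing registered here.
[cite: Balaban1985Variational, Thm 1 (8)–(9) p.279, (144)–(152) pp.300–301, Prop. 8 p.304; Balaban1988Convergent, Thm 1 p.262, (2.1) p.254, (2.21) p.258, p.257; Balaban1989LargeFieldI, (0.2)–(0.4) p.176] -/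
theorem exists_k0SepCoPH_thm1CCMWZB_gridGuard_of_thm1RegSepCoP7MGB_of_gauge9TopStepGB_lam (F : T4Family) {Dat : TopData F 2} (hγ0 : 0 < γ) (hγ : γ ≤ 1 / 2) (hbg : 0 < εbg) (hε : 0 < ε₀) (hε' : 0 < ε₂₉)
    (hB : 0 ≤ B₃) (hB' : 0 ≤ B₃') (ha₀ : 0 < a₀) (ha₁ : 0 < a₁) (hc : c ≤ F.L ^ j) (hc₀ : c₀ ≤ j + 1) (hc₁ : c₁ ≤ j)
    (h15 : VariationalThm1RegSepCoP7MGB F 2 (fun ν M g K k _s => c ≤ ν.M₁ ∧ k + c₀ ≤ F.m + K ∧ F.L ^ c₁ ∣ M ∧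
      ∀ i, 1 ≤ i → i ≤ k → dCubeSide (F.P K).L M (RkOfRecord (F.P K).L ν.r (g i)) i ∣ (F.P K).sitesPerDir 0) (lamDatum F) Dat B₃ a₀ a₁)
    (h9 : Gauge9RegSepTopStepGB F 2 (fun ν K Ω => suppDomOfRecord F ν K Ω) (F.L ^ j) (fun ν M g K k _s => c ≤ ν.M₁ ∧ k + c₀ ≤ F.m + K ∧ F.L ^ c₁ ∣ M ∧
      ∀ i, 1 ≤ i → i ≤ k → dCubeSide (F.P K).L M (RkOfRecord (F.P K).L ν.r (g i)) i ∣ (F.P K).sitesPerDir 0) (lamDatum F) Dat B₃ B₃' a₀ a₁)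
    (hDat : ∀ (θ : Stage13Params F 2) (p : B12.RunParams) (n : ℕ) (s : SeqOfRecord F θ.ν θ.τ9.M (gOfRecord₁₃ F 2 θ p) p.K n) (δ : ℕ → ℝ) (W : MSField (F.P p.K) (SU 2)),
      n ≤ p.K → PartCompat₁₃ F 2 θ p n →
      Sect2.DataSmall7PTop (avOfRecord F 2 p.K) s.Ω (suppDomOfRecord F θ.ν p.K s.Ω) n δ W → Dat p.K s.Ω (suppDomOfRecord F θ.ν p.K s.Ω) n δ W)
    (hseam : ∀ (θ : Stage13Params F 2) (p : B12.RunParams) (n : ℕ) (s : SeqOfRecord F θ.ν θ.τ9.M (gOfRecord₁₃ F 2 θ p) p.K (n + 1)) (W : MSField (F.P p.K) (SU 2)),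
      UbgOfRecord₁₃CoP F 2 θ p (n + 1) s W = UbgMSCoPOfRecordB F 2 θ.ν θ.τ9.M (gOfRecord₁₃ F 2 θ p) p.K (n + 1) s W)
    (hcomp : ∀ (p : B12.RunParams) (n : ℕ), n ≤ p.K → Step.InInterval (theta13OfThm1CCMWZB F 2 j γ εbg ε₀ ε₂₉ B₃ B₃' a₀ a₁ Efl logz).γ n (gOfRecord₁₃ F 2 (theta13OfThm1CCMWZB F 2 j γ εbg ε₀ ε₂₉ B₃ B₃' a₀ a₁ Efl logz) p) → ∀ m, m < n →
      (theta13OfThm1CCMWZB F 2 j γ εbg ε₀ ε₂₉ B₃ B₃' a₀ a₁ Efl logz).s2.cR * epsOfRecord (theta13OfThm1CCMWZB F 2 j γ εbg ε₀ ε₂₉ B₃ B₃' a₀ a₁ Efl logz).ν (gOfRecord₁₃ F 2 (theta13OfThm1CCMWZB F 2 j γ εbg ε₀ ε₂₉ B₃ B₃' a₀ a₁ Efl logz) p) m ≤ 2 * ((theta13OfThm1CCMWZB F 2 j γ εbg ε₀ ε₂₉ B₃ B₃' a₀ a₁ Efl logz).s2.cR * epsOfRecord (theta13OfThm1CCMWZB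 F 2 j γ εbg ε₀ ε₂₉ B₃ B₃' a₀ a₁ Efl logz).ν (gOfRecord₁₃ F 2 (theta13OfThm1CCMWZB F 2 j γ εbg ε₀ ε₂₉ B₃ B₃' a₀ a₁ Efl logz) p) (m + 1)))
    (hcompRev : ∀ (p : B12.RunParams) (n : ℕ), n ≤ p.K → Step.InInterval (theta13OfThm1CCMWZB F 2 j γ εbg ε₀ ε₂₉ B₃ B₃' a₀ a₁ Efl logz).γ n (gOfRecord₁₃ F 2 (theta13OfThm1CCMWZB F 2 j γ εbg ε₀ ε₂₉ B₃ B₃' a₀ a₁ Efl logz) p) → ∀ m, m < n →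
      (theta13OfThm1CCMWZB F 2 j γ εbg ε₀ ε₂₉ B₃ B₃' a₀ a₁ Efl logz).s2.cR * epsOfRecord (theta13OfThm1CCMWZB F 2 j γ εbg ε₀ ε₂₉ B₃ B₃' a₀ a₁ Efl logz).ν (gOfRecord₁₃ F 2 (theta13OfThm1CCMWZB F 2 j γ εbg ε₀ ε₂₉ B₃ B₃' a₀ a₁ Efl logz) p) (m + 1) ≤ 2 * ((theta13OfThm1CCMWZB F 2 j γ εbg ε₀ ε₂₉ B₃ B₃' a₀ a₁ Efl logz).s2.cR * epsOfRecord (theta13OfThm1CCMWZB F 2 j γ εbg ε₀ ε₂₉ B₃ B₃' a₀ a₁ Efl logz).ν (gOfRecord₁₃ F 2 (theta13OfThm1CCMWZB F 2 j γ εbg ε₀ ε₂₉ B₃ B₃' a₀ a₁ Efl logz) p) m)) :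
    ∃ θ : Stage13HParams F 2, θ.Provisos₁₃SepCoPH F 2 ∧ (θ.ZhUnity F 2 ∧ θ.SlotsNondegenerate₁₃ F 2) ∧ θ.Admissible F 2 :=
  exists_k0SepCoPH_thm1CCMWZB_gridGuard_of_thm1RegSepCoP7MGB_of_thm1GaugeGB_lam F hγ0 hγ hbg hε hε' hB hB' ha₀ ha₁ hc hc₀ hc₁ h15
    (variationalThm1GaugeRegSepCoP7MGB_of_gauge9TopStepGB h9) hDat hseam hcomp hcompRev


/-- **★★ THE ⁷ K0 BODY FROM THE (8)-STEP SENTENCE UNDER THE CANDIDATE GUARD** — what V21-G's stub 1-G‴ displays (`Prop8RegSepTopStepG F 2 suppDom Adm B₃ a₀ a₁` at the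
four-conjunct `Adm`), through dag-n07-e module 53's guard-generic bridge `variationalThm1RegSepCoP7MG_of_prop8TopStepG` and the closer above.  CONDITIONAL on the two sentences;
NOT a registered text; K0⁷ OPEN. [cite: Balaban1985Variational, Thm 1 (8)–(9) p.279, Prop. 8 p.304, p.304 lines 1–2; Balaban1988Convergent, Thm 1 p.262, (2.1) p.254, p.257; Balaban1987RG1, (0.1) p.251] -/
theorem exists_k0SepCoPH_thm1CCMWZB_gridGuard_of_prop8TopStepGB_of_gauge9TopStepGB_lam (F : T4Family) {Dat : TopData F 2} (hγ0 : 0 < γ) (hγ : γ ≤ 1 / 2) (hbg : 0 < εbg) (hε : 0 < ε₀) (hε' : 0 < ε₂₉)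
    (hB : 0 < B₃) (hB' : 0 ≤ B₃') (ha₀ : 0 < a₀) (ha₁ : 0 < a₁) (hc : c ≤ F.L ^ j) (hc₀ : c₀ ≤ j + 1) (hc₁ : c₁ ≤ j)
    (h8 : Prop8RegSepTopStepGB F 2 (fun ν K Ω => suppDomOfRecord F ν K Ω) (fun ν M g K k _s => c ≤ ν.M₁ ∧ k + c₀ ≤ F.m + K ∧ F.L ^ c₁ ∣ M ∧
      ∀ i, 1 ≤ i → i ≤ k → dCubeSide (F.P K).L M (RkOfRecord (F.P K).L ν.r (g i)) i ∣ (F.P K).sitesPerDir 0) (lamDatum F) Dat B₃ a₀ a₁)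
    (h9 : Gauge9RegSepTopStepGB F 2 (fun ν K Ω => suppDomOfRecord F ν K Ω) (F.L ^ j) (fun ν M g K k _s => c ≤ ν.M₁ ∧ k + c₀ ≤ F.m + K ∧ F.L ^ c₁ ∣ M ∧
      ∀ i, 1 ≤ i → i ≤ k → dCubeSide (F.P K).L M (RkOfRecord (F.P K).L ν.r (g i)) i ∣ (F.P K).sitesPerDir 0) (lamDatum F) Dat B₃ B₃' a₀ a₁)
    (hDat : ∀ (θ : Stage13Params F 2) (p : B12.RunParams) (n : ℕ) (s : SeqOfRecord F θ.ν θ.τ9.M (gOfRecord₁₃ F 2 θ p) p.K n) (δ : ℕ → ℝ) (W : MSField (F.P p.K) (SU 2)),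
      n ≤ p.K → PartCompat₁₃ F 2 θ p n →
      Sect2.DataSmall7PTop (avOfRecord F 2 p.K) s.Ω (suppDomOfRecord F θ.ν p.K s.Ω) n δ W → Dat p.K s.Ω (suppDomOfRecord F θ.ν p.K s.Ω) n δ W)
    (hseam : ∀ (θ : Stage13Params F 2) (p : B12.RunParams) (n : ℕ) (s : SeqOfRecord F θ.ν θ.τ9.M (gOfRecord₁₃ F 2 θ p) p.K (n + 1)) (W : MSField (F.P p.K) (SU 2)),
      UbgOfRecord₁₃CoP F 2 θ p (n + 1) s W = UbgMSCoPOfRecordB F 2 θ.ν θ.τ9.M (gOfRecord₁₃ F 2 θ p) p.K (n + 1) s W)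
    (hcomp : ∀ (p : B12.RunParams) (n : ℕ), n ≤ p.K → Step.InInterval (theta13OfThm1CCMWZB F 2 j γ εbg ε₀ ε₂₉ B₃ B₃' a₀ a₁ Efl logz).γ n (gOfRecord₁₃ F 2 (theta13OfThm1CCMWZB F 2 j γ εbg ε₀ ε₂₉ B₃ B₃' a₀ a₁ Efl logz) p) → ∀ m, m < n →
      (theta13OfThm1CCMWZB F 2 j γ εbg ε₀ ε₂₉ B₃ B₃' a₀ a₁ Efl logz).s2.cR * epsOfRecord (theta13OfThm1CCMWZB F 2 j γ εbg ε₀ ε₂₉ B₃ B₃' a₀ a₁ Efl logz).ν (gOfRecord₁₃ F 2 (theta13OfThm1CCMWZB F 2 j γ εbg ε₀ ε₂₉ B₃ B₃' a₀ a₁ Efl logz) p) m ≤ 2 * ((theta13OfThm1CCMWZB F 2 j γ εbg ε₀ ε₂₉ B₃ B₃' a₀ a₁ Efl logz).s2.cR * epsOfRecord (theta13OfThm1CCMWZB F 2 j γ εbg ε₀ ε₂₉ B₃ B₃' a₀ a₁ Efl logz).ν (gOfRecord₁₃ F 2 (theta13OfThm1CCMWZB F 2 j γ εbg ε₀ ε₂₉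 B₃ B₃' a₀ a₁ Efl logz) p) (m + 1)))
    (hcompRev : ∀ (p : B12.RunParams) (n : ℕ), n ≤ p.K → Step.InInterval (theta13OfThm1CCMWZB F 2 j γ εbg ε₀ ε₂₉ B₃ B₃' a₀ a₁ Efl logz).γ n (gOfRecord₁₃ F 2 (theta13OfThm1CCMWZB F 2 j γ εbg ε₀ ε₂₉ B₃ B₃' a₀ a₁ Efl logz) p) → ∀ m, m < n →
      (theta13OfThm1CCMWZB F 2 j γ εbg ε₀ ε₂₉ B₃ B₃' a₀ a₁ Efl logz).s2.cR * epsOfRecord (theta13OfThm1CCMWZB F 2 j γ εbg ε₀ ε₂₉ B₃ B₃' a₀ a₁ Efl logz).ν (gOfRecord₁₃ F 2 (theta13OfThm1CCMWZB F 2 j γ εbg ε₀ ε₂₉ B₃ B₃' a₀ a₁ Efl logz) p) (m + 1) ≤ 2 * ((theta13OfThm1CCMWZB F 2 j γ εbg ε₀ ε₂₉ B₃ B₃' a₀ a₁ Efl logz).s2.cR * epsOfRecord (theta13OfThm1CCMWZB F 2 j γ εbg ε₀ ε₂₉ B₃ B₃' a₀ a₁ Efl logz).ν (gOfRecord₁₃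 F 2 (theta13OfThm1CCMWZB F 2 j γ εbg ε₀ ε₂₉ B₃ B₃' a₀ a₁ Efl logz) p) m)) :
    ∃ θ : Stage13HParams F 2, θ.Provisos₁₃SepCoPH F 2 ∧ (θ.ZhUnity F 2 ∧ θ.SlotsNondegenerate₁₃ F 2) ∧ θ.Admissible F 2 :=
  exists_k0SepCoPH_thm1CCMWZB_gridGuard_of_thm1RegSepCoP7MGB_of_gauge9TopStepGB_lam F hγ0 hγ hbg hε hε' hB.le hB' ha₀ ha₁ hc hc₀ hc₁
    (variationalThm1RegSepCoP7MGB_of_prop8TopStepGB_lamDatum hB h8) h9 hDat hseam hcomp hcompRev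

end ClosersGridGuardZB

/-! ## §4  PART 1-G‴ AT THE Z3 MEMBER: the body at an arbitrary cube letter, the stub-level composition with a GENERIC (9)-supplier (box at `εbg := a₀`), NODE O's socket -/

section Part1GridGuardedZB

variable {Efl logz : B12.RunParams → ℕ → ℝ}

/-- **★ THE ⁷ K0 BODY FOR `F` AT AN ARBITRARY CUBE LETTER `(L^j, c, c₀, c₁)` WITH `c ≤ L^j`, `c₀ ≤ j + 1`, `c₁ ≤ j`, FROM THE (8)-SENTENCE AND THE (9)-TOKEN UNDER `A‴` AND ONE ABS
β-BOX OF `θ₁₅ᶜᶜᴹᵂᶻᴮ(j; ½; εbg)`** — k0-s1-w3's `exists_k0H_of_thm1CoP7MG3_of_gauge9G3_of_absBox` at Z3: §3's `clausesH_of_absBoxZB` (token-free) gives (hcomp) ∧ (hcompRev) at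
`θ₁₅ᶜᶜᴹᵂᶻᴮ(j; γ; εbg)`, then §2.  CONDITIONAL. [cite: Balaban1985Variational, Thm 1 (8)–(9) p.279, (144)–(152) pp.300–301, Prop. 8 p.304, p.304 lines 1–2; Balaban1988Convergent, Thm 1 p.262, (2.1) p.254, (2.5)–(2.8) pp.255–256, p.257, (2.21) p.258; Balaban1987RG1, Thm 1 p.259, (0.1) p.251, (1.12) p.262, §1 p.264] -/
theorem exists_k0H_of_thm1CoP7MGB_of_gauge9GB_of_absBoxZB_lam (F : T4Family) {Dat : TopData F 2} {j c c₀ c₁ : ℕ} (hc : c ≤ F.L ^ j) (hc₀ : c₀ ≤ j + 1) (hc₁ : c₁ ≤ j) {εbg B₃ B₉ a₀ a₁ : ℝ} (hbg : 0 < εbg) (hB₃ : 0 ≤ B₃) (hB₉ : 0 ≤ B₉)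
    (ha₀ : 0 < a₀) (ha₁ : 0 < a₁) (h15 : VariationalThm1RegSepCoP7MGB F 2 (fun ν M g K k _s => c ≤ ν.M₁ ∧ k + c₀ ≤ F.m + K ∧ F.L ^ c₁ ∣ M ∧
      ∀ i, 1 ≤ i → i ≤ k → dCubeSide (F.P K).L M (RkOfRecord (F.P K).L ν.r (g i)) i ∣ (F.P K).sitesPerDir 0) (lamDatum F) Dat B₃ a₀ a₁)
    (h9 : Gauge9RegSepTopStepGB F 2 (fun ν K Ω => suppDomOfRecord F ν K Ω) (F.L ^ j) (fun ν M g K k _s => c ≤ ν.M₁ ∧ k + c₀ ≤ F.m + K ∧ F.L ^ c₁ ∣ M ∧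
      ∀ i, 1 ≤ i → i ≤ k → dCubeSide (F.P K).L M (RkOfRecord (F.P K).L ν.r (g i)) i ∣ (F.P K).sitesPerDir 0) (lamDatum F) Dat B₃ B₉ a₀ a₁)
    (hDat : ∀ (θ : Stage13Params F 2) (p : B12.RunParams) (n : ℕ) (s : SeqOfRecord F θ.ν θ.τ9.M (gOfRecord₁₃ F 2 θ p) p.K n) (δ : ℕ → ℝ) (W : MSField (F.P p.K) (SU 2)),
      n ≤ p.K → PartCompat₁₃ F 2 θ p n →
      Sect2.DataSmall7PTop (avOfRecord F 2 p.K) s.Ω (suppDomOfRecord F θ.ν p.K s.Ω) n δ W → Dat p.K s.Ω (suppDomOfRecord F θ.ν p.K s.Ω) n δ W)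
    (hseam : ∀ (θ : Stage13Params F 2) (p : B12.RunParams) (n : ℕ) (s : SeqOfRecord F θ.ν θ.τ9.M (gOfRecord₁₃ F 2 θ p) p.K (n + 1)) (W : MSField (F.P p.K) (SU 2)),
      UbgOfRecord₁₃CoP F 2 θ p (n + 1) s W = UbgMSCoPOfRecordB F 2 θ.ν θ.τ9.M (gOfRecord₁₃ F 2 θ p) p.K (n + 1) s W)
    (h3A : ∃ γ₀ ε₀ ε₂₉ β' : ℝ, 0 < γ₀ ∧ 0 < ε₀ ∧ 0 < ε₂₉ ∧
        BetaLowerH (-β') γ₀ (betaOfRecord₁₃ F 2 (theta13OfThm1CCMWZB F 2 j (1 / 2) εbg ε₀ ε₂₉ B₃ B₉ a₀ a₁ Efl logz)) ∧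
        BetaUpperH β' γ₀ (betaOfRecord₁₃ F 2 (theta13OfThm1CCMWZB F 2 j (1 / 2) εbg ε₀ ε₂₉ B₃ B₉ a₀ a₁ Efl logz))) :
    ∃ θ : Stage13HParams F 2, θ.Provisos₁₃SepCoPH F 2 ∧ (θ.ZhUnity F 2 ∧ θ.SlotsNondegenerate₁₃ F 2) ∧ θ.Admissible F 2 := by
  -- ONE abs β-box of the half-window member ⟹ the sign-free clauses at some window `γ ≤ ½` (the (b) file's `clausesH_of_absBoxZB`, inlined: window shrink + A2ʷ-ZB §6′)
  obtain ⟨γ₀, ε₀, ε₂₉, β', hγ00, hε, hε', hlow, hup⟩ := h3A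
  have hv : (fun _ : Fin (0 + 1) => γ₀) ∈ Box γ₀ 0 := mem_box.mpr fun _ => ⟨hγ00, le_rfl⟩
  have hβ' : 0 ≤ β' := by
    have h1 := hlow 0 _ hv
    have h2 := hup 0 _ hv
    linarith
  obtain ⟨γ, hγ0, hγle, hγ, hl, hu⟩ := exists_window_letters_signFree hγ00 hβ'
  obtain ⟨hcomp, hcompRev⟩ := hcompBoth_theta13OfThm1CCMWZB_of_betaBoxSignFree_half (Efl := Efl) (logz := logz) (ε₀ := ε₀) (ε₂₉ := ε₂₉) (εbg := εbg)
    hγ hB₃ hB₉ ha₀.le ha₁.le (fun k v hv => hlow k v (box_mono hγle k hv)) (fun k v hv => hup k v (box_mono hγle k hv)) hl hu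
  exact exists_k0SepCoPH_thm1CCMWZB_gridGuard_of_thm1RegSepCoP7MGB_of_gauge9TopStepGB_lam F hγ0 hγ hbg hε hε' hB₃ hB₉ ha₀ ha₁ hc hc₀ hc₁ h15 h9 hDat hseam hcomp hcompRev

/-- **★★ K0⁷'s BODY AT EVERY FAMILY FROM THE CANDIDATE STUB 1-G‴, A GENERIC (9)-SUPPLIER UNDER `A‴`, AND THE CANDIDATE 3ᴬ′-G‴** — k0-s1-w3's
`record13SepCoPHBody_of_stub1G3_of_gauge9SupplierG3_of_absBetaBoxAtG3` with the 3ᴬ′ box read at the Z3 member `εbg := a₀` (proof VERBATIM otherwise: stub 1 ⇒ the guarded (8)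
`CoP` sentence by module 53, ceiling shrunk by `.of_le`, guard refined `(c, c₀, c₁) → (c′, c₀, c₁)` by `.of_imp`; `hSG` ⇒ (9); `h3A'G` ⇒ the box ⇒ §1's first theorem).  CONDITIONAL; the
texts here are stub 1-G‴ of V21-G (REGISTERED) and the 3ᴬ′-G‴ text RE-READ AT THE Z3 MEMBER (plan g91 K0-AT-Z3 word 2026-08-29 07:15Z: the V22-Z CANDIDATE, NOT registered); K0⁷ NOT closed; nothing of Bałaban asserted.
[cite: Balaban1985Variational, Thm 1 (8)–(9) p.279, (144)–(152) pp.300–301, Prop. 8 p.304, p.304 lines 1–2; Balaban1985RegularSpaces, (1.3)–(1.6) p.77, Prop. 6 p.99; Balaban1988Convergent, Thm 1 p.262, (2.1) p.254, (2.5)–(2.8) pp.255–256, p.257; Balaban1987RG1, Thm 1 p.259, (0.1) p.251, §1 p.264] -/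
theorem record13SepCoPHBody_of_stub1GB_of_gauge9SupplierGB_of_absBetaBoxAtGBZB_lam {DatF : (F : T4Family) → TopData F 2}
    (hDat : ∀ (F : T4Family) (θ : Stage13Params F 2) (p : B12.RunParams) (n : ℕ) (s : SeqOfRecord F θ.ν θ.τ9.M (gOfRecord₁₃ F 2 θ p) p.K n) (δ : ℕ → ℝ) (W : MSField (F.P p.K) (SU 2)),
      n ≤ p.K → PartCompat₁₃ F 2 θ p n →
      Sect2.DataSmall7PTop (avOfRecord F 2 p.K) s.Ω (suppDomOfRecord F θ.ν p.K s.Ω) n δ W → DatF F p.K s.Ω (suppDomOfRecord F θ.ν p.K s.Ω) n δ W)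
    (hseam : ∀ (F : T4Family) (θ : Stage13Params F 2) (p : B12.RunParams) (n : ℕ) (s : SeqOfRecord F θ.ν θ.τ9.M (gOfRecord₁₃ F 2 θ p) p.K (n + 1)) (W : MSField (F.P p.K) (SU 2)),
      UbgOfRecord₁₃CoP F 2 θ p (n + 1) s W = UbgMSCoPOfRecordB F 2 θ.ν θ.τ9.M (gOfRecord₁₃ F 2 θ p) p.K (n + 1) s W)
    (h1G : ∀ F : T4Family, ∃ (c c₀ c₁ : ℕ) (B₃ a₀ a₁ : ℝ), 2 * (F.L : ℝ) ^ 2 ≤ B₃ ∧ 0 < a₀ ∧ 0 < a₁ ∧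
      Prop8RegSepTopStepGB F 2 (fun ν K Ω => suppDomOfRecord F ν K Ω) (fun ν M g K k _s => c ≤ ν.M₁ ∧ k + c₀ ≤ F.m + K ∧ F.L ^ c₁ ∣ M ∧
      ∀ i, 1 ≤ i → i ≤ k → dCubeSide (F.P K).L M (RkOfRecord (F.P K).L ν.r (g i)) i ∣ (F.P K).sitesPerDir 0) (lamDatum F) (DatF F) B₃ a₀ a₁)
    (hSG : ∀ (F : T4Family) (c c₀ c₁ : ℕ) (B₃ a₀ a₁ : ℝ), 2 * (F.L : ℝ) ^ 2 ≤ B₃ → 0 < a₀ → 0 < a₁ →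
      Prop8RegSepTopStepGB F 2 (fun ν K Ω => suppDomOfRecord F ν K Ω) (fun ν M g K k _s => c ≤ ν.M₁ ∧ k + c₀ ≤ F.m + K ∧ F.L ^ c₁ ∣ M ∧
      ∀ i, 1 ≤ i → i ≤ k → dCubeSide (F.P K).L M (RkOfRecord (F.P K).L ν.r (g i)) i ∣ (F.P K).sitesPerDir 0) (lamDatum F) (DatF F) B₃ a₀ a₁ →
      ∃ (j c' : ℕ) (B₉ a₁' : ℝ), c ≤ c' ∧ c' ≤ F.L ^ j ∧ c₀ ≤ j + 1 ∧ c₁ ≤ j ∧ 0 < B₉ ∧ 0 < a₁' ∧ a₁' ≤ a₁ ∧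
        Gauge9RegSepTopStepGB F 2 (fun ν K Ω => suppDomOfRecord F ν K Ω) (F.L ^ j) (fun ν M g K k _s => c' ≤ ν.M₁ ∧ k + c₀ ≤ F.m + K ∧ F.L ^ c₁ ∣ M ∧
      ∀ i, 1 ≤ i → i ≤ k → dCubeSide (F.P K).L M (RkOfRecord (F.P K).L ν.r (g i)) i ∣ (F.P K).sitesPerDir 0) (lamDatum F) (DatF F) B₃ B₉ a₀ a₁')
    (h3A'G : ∀ (F : T4Family) (j c c₀ c₁ : ℕ) (B₃ B₃' a₀ a₁ : ℝ), c ≤ F.L ^ j → c₀ ≤ j + 1 → c₁ ≤ j → 2 * (F.L : ℝ) ^ 2 ≤ B₃ → 0 < B₃' → 0 < a₀ → 0 < a₁ →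
      VariationalThm1RegSepCoP7MGB F 2 (fun ν M g K k _s => c ≤ ν.M₁ ∧ k + c₀ ≤ F.m + K ∧ F.L ^ c₁ ∣ M ∧
      ∀ i, 1 ≤ i → i ≤ k → dCubeSide (F.P K).L M (RkOfRecord (F.P K).L ν.r (g i)) i ∣ (F.P K).sitesPerDir 0) (lamDatum F) (DatF F) B₃ a₀ a₁ →
      Gauge9RegSepTopStepGB F 2 (fun ν K Ω => suppDomOfRecord F ν K Ω) (F.L ^ j) (fun ν M g K k _s => c ≤ ν.M₁ ∧ k + c₀ ≤ F.m + K ∧ F.L ^ c₁ ∣ M ∧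
      ∀ i, 1 ≤ i → i ≤ k → dCubeSide (F.P K).L M (RkOfRecord (F.P K).L ν.r (g i)) i ∣ (F.P K).sitesPerDir 0) (lamDatum F) (DatF F) B₃ B₃' a₀ a₁ →
      ∃ γ₀ ε₀ ε₂₉ β' : ℝ, 0 < γ₀ ∧ 0 < ε₀ ∧ 0 < ε₂₉ ∧
        BetaLowerH (-β') γ₀ (betaOfRecord₁₃ F 2 (theta13OfThm1CCMWZB F 2 j (1 / 2) a₀ ε₀ ε₂₉ B₃ B₃' a₀ a₁ Efl logz)) ∧
        BetaUpperH β' γ₀ (betaOfRecord₁₃ F 2 (theta13OfThm1CCMWZB F 2 j (1 / 2) a₀ ε₀ ε₂₉ B₃ B₃' a₀ a₁ Efl logz))) :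
    ∀ F : T4Family, ∃ θ : Stage13HParams F 2, θ.Provisos₁₃SepCoPH F 2 ∧ (θ.ZhUnity F 2 ∧ θ.SlotsNondegenerate₁₃ F 2) ∧ θ.Admissible F 2 := by
  intro F
  obtain ⟨c, c₀, c₁, B₃, a₀, a₁, hB₃, ha₀, ha₁, h8⟩ := h1G F
  have hL : (0 : ℝ) < (F.L : ℝ) := by exact_mod_cast lt_trans Nat.zero_lt_one F.hL.2
  have hBpos : (0 : ℝ) < B₃ := lt_of_lt_of_le (mul_pos two_pos (pow_pos hL 2)) hB₃
  obtain ⟨j, c', B₉, a₁', hcc', hc', hc₀, hc₁, hB₉, ha₁', ha₁'le, h9⟩ := hSG F c c₀ c₁ B₃ a₀ a₁ hB₃ ha₀ ha₁ h8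
  have h15 : VariationalThm1RegSepCoP7MGB F 2 (fun ν M g K k _s => c' ≤ ν.M₁ ∧ k + c₀ ≤ F.m + K ∧ F.L ^ c₁ ∣ M ∧
      ∀ i, 1 ≤ i → i ≤ k → dCubeSide (F.P K).L M (RkOfRecord (F.P K).L ν.r (g i)) i ∣ (F.P K).sitesPerDir 0) (lamDatum F) (DatF F) B₃ a₀ a₁' :=
    (variationalThm1RegSepCoP7MGB_of_prop8TopStepGB_lamDatum hBpos (h8.of_le le_rfl ha₁'le)).of_imp fun _ _ _ _ _ _ h => ⟨hcc'.trans h.1, h.2⟩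
  exact exists_k0H_of_thm1CoP7MGB_of_gauge9GB_of_absBoxZB_lam F hc' hc₀ hc₁ ha₀ hBpos.le hB₉.le ha₀ ha₁' h15 h9 (hDat F) (hseam F)
    (h3A'G F j c' c₀ c₁ B₃ B₉ a₀ a₁' hc' hc₀ hc₁ hB₃ hB₉ ha₀ ha₁' h15 h9)

end Part1GridGuardedZB

/-! ## §5  ★★★ The CANDIDATE V22-Z composition: V21-G's FILE 4‴ with 3ᴬ′-G‴'s box read at the Z3 member (`εbg := a₀`) — kernel check of the plan's one substitution -/

section CompositionGridGuardedZB

variable {Efl logz : B12.RunParams → ℕ → ℝ}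

/-- **★★★ K0⁷'s BODY AT EVERY FAMILY FROM THE CANDIDATE STUB 1-G‴, STUB 2′ AND THE CANDIDATE 3ᴬ′-G‴** — `h1G3` = the V21-G candidate stub-1 text ([15] Prop. 8's top step at the
record's support selector under `A‴(c, c₀, c₁)` for SOME `(c, c₀, c₁)` and guarded `(B₃, a₀, a₁)`); `h2P` = STUB 2′ VERBATIM (landed p595104); `h3A'G3` = the 3ᴬ′-G‴ candidate (binders
`(j c c₀ c₁)`, riders `c₀ ≤ j + 1`, `c₁ ≤ j`, both antecedents under `A‴`).  Proof: §2's supplier, then §1.  The shape a V21-G skeleton's `Record13SepCoPHInhabited_of h1G h2P h3A'G` would cite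
BY NAME.  CONDITIONAL; the texts are CANDIDATES, NOT registered; K0⁷ NOT closed; nothing of Bałaban asserted; a re-text is not progress.
[cite: Balaban1985Variational, Thm 1 (8)–(9) p.279, (144)–(152) pp.300–301, Prop. 8 p.304, p.304 lines 1–2; Balaban1985RegularSpaces, (1.3)–(1.6) p.77, Prop. 6 p.99, p.98; Balaban1988Convergent, Thm 1 p.262, (2.1) p.254, (2.5)–(2.8) pp.255–256, p.257; Balaban1987RG1, Thm 1 p.259, (0.1) p.251, §1 p.264] -/
theorem record13SepCoPHBody_of_stubs1GB_2P_3A'GBZB_lam {DatF : (F : T4Family) → TopData F 2}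
    (hDat : ∀ (F : T4Family) (θ : Stage13Params F 2) (p : B12.RunParams) (n : ℕ) (s : SeqOfRecord F θ.ν θ.τ9.M (gOfRecord₁₃ F 2 θ p) p.K n) (δ : ℕ → ℝ) (W : MSField (F.P p.K) (SU 2)),
      n ≤ p.K → PartCompat₁₃ F 2 θ p n →
      Sect2.DataSmall7PTop (avOfRecord F 2 p.K) s.Ω (suppDomOfRecord F θ.ν p.K s.Ω) n δ W → DatF F p.K s.Ω (suppDomOfRecord F θ.ν p.K s.Ω) n δ W)
    (hseam : ∀ (F : T4Family) (θ : Stage13Params F 2) (p : B12.RunParams) (n : ℕ) (s : SeqOfRecord F θ.ν θ.τ9.M (gOfRecord₁₃ F 2 θ p) p.K (n + 1)) (W : MSField (F.P p.K) (SU 2)),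
      UbgOfRecord₁₃CoP F 2 θ p (n + 1) s W = UbgMSCoPOfRecordB F 2 θ.ν θ.τ9.M (gOfRecord₁₃ F 2 θ p) p.K (n + 1) s W)
    (h1G : ∀ F : T4Family, ∃ (c c₀ c₁ : ℕ) (B₃ a₀ a₁ : ℝ), 2 * (F.L : ℝ) ^ 2 ≤ B₃ ∧ 0 < a₀ ∧ 0 < a₁ ∧
      Prop8RegSepTopStepGB F 2 (fun ν K Ω => suppDomOfRecord F ν K Ω) (fun ν M g K k _s => c ≤ ν.M₁ ∧ k + c₀ ≤ F.m + K ∧ F.L ^ c₁ ∣ M ∧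
      ∀ i, 1 ≤ i → i ≤ k → dCubeSide (F.P K).L M (RkOfRecord (F.P K).L ν.r (g i)) i ∣ (F.P K).sitesPerDir 0) (lamDatum F) (DatF F) B₃ a₀ a₁)
    (h2P : ∀ F : T4Family, ∃ (ρ₀ : ℕ) (B₁ c₁ : ℝ), 1 ≤ ρ₀ ∧ 0 ≤ B₁ ∧ 0 < c₁ ∧
      (letI : CStarAlgebra (MatA 2) := {}; B8.Prop6Printed 4 (F.L : ℝ) B₁ c₁ (fun i : ZdIdx 4 F.L => zdCubP (MatA 2) F.L ρ₀ i)))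
    (h3A'G : ∀ (F : T4Family) (j c c₀ c₁ : ℕ) (B₃ B₃' a₀ a₁ : ℝ), c ≤ F.L ^ j → c₀ ≤ j + 1 → c₁ ≤ j → 2 * (F.L : ℝ) ^ 2 ≤ B₃ → 0 < B₃' → 0 < a₀ → 0 < a₁ →
      VariationalThm1RegSepCoP7MGB F 2 (fun ν M g K k _s => c ≤ ν.M₁ ∧ k + c₀ ≤ F.m + K ∧ F.L ^ c₁ ∣ M ∧
      ∀ i, 1 ≤ i → i ≤ k → dCubeSide (F.P K).L M (RkOfRecord (F.P K).L ν.r (g i)) i ∣ (F.P K).sitesPerDir 0) (lamDatum F) (DatF F) B₃ a₀ a₁ →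
      Gauge9RegSepTopStepGB F 2 (fun ν K Ω => suppDomOfRecord F ν K Ω) (F.L ^ j) (fun ν M g K k _s => c ≤ ν.M₁ ∧ k + c₀ ≤ F.m + K ∧ F.L ^ c₁ ∣ M ∧
      ∀ i, 1 ≤ i → i ≤ k → dCubeSide (F.P K).L M (RkOfRecord (F.P K).L ν.r (g i)) i ∣ (F.P K).sitesPerDir 0) (lamDatum F) (DatF F) B₃ B₃' a₀ a₁ →
      ∃ γ₀ ε₀ ε₂₉ β' : ℝ, 0 < γ₀ ∧ 0 < ε₀ ∧ 0 < ε₂₉ ∧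
        BetaLowerH (-β') γ₀ (betaOfRecord₁₃ F 2 (theta13OfThm1CCMWZB F 2 j (1 / 2) a₀ ε₀ ε₂₉ B₃ B₃' a₀ a₁ Efl logz)) ∧
        BetaUpperH β' γ₀ (betaOfRecord₁₃ F 2 (theta13OfThm1CCMWZB F 2 j (1 / 2) a₀ ε₀ ε₂₉ B₃ B₃' a₀ a₁ Efl logz))) :
    ∀ F : T4Family, ∃ θ : Stage13HParams F 2, θ.Provisos₁₃SepCoPH F 2 ∧ (θ.ZhUnity F 2 ∧ θ.SlotsNondegenerate₁₃ F 2) ∧ θ.Admissible F 2 :=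
  record13SepCoPHBody_of_stub1GB_of_gauge9SupplierGB_of_absBetaBoxAtGBZB_lam hDat hseam h1G
    (fun F c c₀ c₁ B₃ a₀ a₁ hB₃ ha₀ ha₁ h8 => gauge9SupplierG3B_of_prop6MemberP F (h2P F) (lamDatum F) (DatF F) c c₀ c₁ B₃ a₀ a₁ hB₃ ha₀ ha₁ h8) h3A'G

end CompositionGridGuardedZB

end Summit.QuantumFields.YangMills.Theorems.K0AllTorusOfStepTokensGuardedZBLam

end
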